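import Literature.MathematicalPhysics.QuantumFieldTheory.Balaban1983to89.Node00.Record12BgRowCoClassGaugeRGuarded
import Literature.MathematicalPhysics.QuantumFieldTheory.Balaban1983to89.Node00.TorusCoverGaugeTokensGuardedB

/-!
# NODE 00 — ROW P11's GAUGE SENTENCE OVER A **BOND-LEVEL DETERMINING DATUM** AND A **TOP-DATA PREDICATE**: [15] THEOREM 1 (9) LINE 1 IN ∃-GAUGE FORM FOR MINIMISERS, GUARD-GENERIC,
# `VariationalThm1GaugeRegSepTop7MGB ∕ VariationalThm1GaugeRegSepCoP7MGB F N (Sup) M Adm bd Dat B₃ B₃' a₀ a₁` — the print-datum parametrisation of module `Record12BgRowCoClassGaugeRGuarded`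
# §1 ∕ §3 ∕ §4 (row S1b-2 of the (E1)∕(iii-b) work plan WORKPLAN-IIIB 27c850bec22d4efe; director-ym №338∕№339; FLAG №16; LOCATE-HSEAM 5d3298b8d191f169), with «minimal ⇒ critical» over a
# bond-datum fibre on the TOP class (module 20 :73's twin) and the supplier from S1b-1's step token `Gauge9RegSepTopStepGB`

Cell `pub-ymgap` (HUMAN RULINGS D-0062 ∕ D-0088 ∕ D-0145), width seat `pub-ymgap-dag-n07-w2` g7 (claim board (iii-b), CLAIM S1b-2 on the cell bus 2026-08-30), 2026-08-30.
`--supports stmt-QuantumFields-20541` (K0⁷; helper; count-neutral).  PURELY ADDITIVE — «print-datum twin of `Node00/Record12BgRowCoClassGaugeRGuarded` §1∕§3∕§4 and of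
`Node00/CriticalOnFibreTop.isCritOnFibre_of_isMinimizer_classTop` (FLAG №16 ∕ LOCATE-HSEAM 5d3298b8d191f169); the (b)-instances `VariationalThm1GaugeRegSepTop7MG ∕ …CoP7MG`
(and dag-n21-c's floor-carrying `…Top7MR ∕ …CoP7MR`, node00-def-P11's floor-free `…Top7M ∕ …CoP7M`) stay landed and true on their own text» — no displayed premise is deleted or
weakened: the data row and the determining datum of the minimiser become PARAMETERS, and the old rows are one instance (`…_iff_GB`, `Iff.rfl`).
CONSUMED BY NAME, nothing modified: `Record12BgRowCoClassGaugeRGuarded` (n07-e g21; the (b)-sentences, `Sect2.LocalGaugeOn`), F0a `B15DeterminingSetsB` (node00-def-RR-2 g23: `IsMinimizerB`,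
`AgreeOnB`), F0b `Node00/CriticalOnFibreB` (n07-e g33: `IsCritOnFibreB`, `deriv_wilsonAction4_eq_zero_of_isMinimizerB`), F0c `Node00/CriticalOnFibreTopGuardedB` (`BondDatum`, `TopData`,
`genSetDatum`, `dataSmall7PTopOf`, `Prop8RegSepTopStepGB`), S1b-1 `Node00/TorusCoverGaugeTokensGuardedB` (this seat: `Gauge9RegSepTopStepGB`, `gauge9GB_of_prop8TopStepGB_of_gauge152R`,
`gauge9GBP_of_prop8TopStepGB_of_prop6P_of_one_le`), module 20 `Node00/CriticalOnFibreTop` (`eventually_mem_classTop`, datum-free).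
[15] = [Balaban1985Variational]; [6] = [Balaban1985RegularSpaces]; [II] = [Balaban1984PropagatorsII]; [III] = [Balaban1988Convergent]; [I] = [Balaban1987RG1].

THE PRINT.  [15] Thm 1 (9) p. 279: for the MINIMISER `U` of (4) under the constraints (3) «there exists a gauge `u` … `U^u = exp iηA`, `|A|, |∇^η A| < B₃ε₁ …`» on the big cubes
of the cube class pp. 278–279; the constraints (3) are averages ON [II] (2.3)'s bond sets «Λ_j = Ω_j^{(j)} ∖ Ω_{j+1}^{(j)} … for the sets of sites and the sets of bonds» (p. 224; the
DIFFERENCE of the bond sets, ruling (α) of record).  Module `Record12BgRowCoClassGaugeRGuarded` states this sentence for the minimiser over READING (b)'s fibre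
(`IsMinimizer (avOfRecord F N K) {class (6)-Top at ε₀} (genSet s.Ω k) W U₀`, [I] p. 251 «bonds which intersect Γ_j») and derives it from module 51's step token for CRITICAL
configurations by «minimal ⇒ critical» (module 20's `isCritOnFibre_of_isMinimizer_classTop`: the class is curve-open, Fermat).  THIS FILE makes the datum and the (7) data row
PARAMETERS `(bd, Dat)` exactly as F0c ∕ S1b-1 do for the step tokens — the (9)-conclusion (local gauges `Sect2.LocalGaugeOn` on the grid cubes inside `Ω_n`) mentions neither — and
re-proves «minimal ⇒ critical» on a bond-datum fibre over the TOP class (F0b carries the (1.7) ∕ (1.7)∧(1.9) classes `omegaPlaqs ∕ CoDivClassOn`; the TOP class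
`omegaPlaqsTop ∕ CoDivClassOnTop` is the one the K0 road's sentences display).  The downstream S1d modules (`Record13SepCoPInhabitedOfThm1{CoPGauge, CCMGaugeR, CCMWGaugeR, …SignFree,
…AllTorus}`) and the `Thm/` road of record (`…K0Stub1GridNumericsGuardWitness`, `…K0AllTorusOfStepTokensGuarded(ZB)`) read exactly these sentences and the supplier
`variationalThm1GaugeRegSepCoP7MG_of_gauge9TopStepG`; their twins key on this file by name (R-keyed consumers instantiate `Adm := floorGuard F c`, `…_iff_GB_floorGuard`).

WHAT IS HERE (sorry-free; TWO definitions (named facts, `Prop`s with parameters, NEVER asserted) + bookkeeping; axioms standard).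
* §0 ★ `isCritOnFibreB_of_isMinimizerB_classTop` — «MINIMAL ⇒ CRITICAL» over print's class (6) on a top domain, on the fibre of ANY bond datum `𝔅` (module 20 :73's proof with F0b's
  Fermat step `deriv_wilsonAction4_eq_zero_of_isMinimizerB`); module 20's statement is the instance `𝔅 := bondsDet 𝔹` (by `rfl` on both predicates; not restated — dedup).
* §1 `VariationalThm1GaugeRegSepTop7MGB F N Sup M Adm bd Dat B₃ B₃' a₀ a₁` (module `…GaugeRGuarded` §1's body with `Dat K s.Ω (Sup ν K s.Ω) k δ W` for the (7) row and
  `IsMinimizerB (avOfRecord F N K) {…} (bd K k s.Ω) W U₀` for the minimiser; every other byte identical); ★ `variationalThm1GaugeRegSepTop7MG_iff_GB` (`Iff.rfl` at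
  `(genSetDatum F, dataSmall7PTopOf F N)`), `variationalThm1GaugeRegSepTop7MR_iff_GB_floorGuard` (`Iff.rfl`), `variationalThm1GaugeRegSepTop7M_iff_GB_top` (floor-free = trivial guard);
  `.of_le ∕ .mono ∕ .of_imp ∕ .of_imp_dat ∕ .and_right ∕ .and_left`; `localGaugeOn_of_thm1GaugeRegSepTop7MGB` (§2's application form at the record's radii letters `cR·ε_n`).
* §2 `VariationalThm1GaugeRegSepCoP7MGB F N M Adm bd Dat B₃ B₃' a₀ a₁` (at def-R's `suppDomOfRecord`, definitional) + `.toTop7MGB ∕ .toCoP7MGB`, `…CoP7MG_iff_GB`, `…CoP7MR_iff_GB_floorGuard`,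
  `…CoP7M_iff_GB_top`, `.of_le ∕ .mono ∕ .of_imp ∕ .of_imp_dat ∕ .and_right ∕ .and_left`.
* §3 ★ `variationalThm1GaugeRegSepTop7MGB_of_gauge9TopStepGB` ∕ ★ `variationalThm1GaugeRegSepCoP7MGB_of_gauge9TopStepGB` (S1b-1's step token over `(bd, Dat)` ⟹ the sentence over the
  SAME `(bd, Dat)`, by §0), ★ `variationalThm1GaugeRegSepCoP7MGB_of_prop8TopStepGB_of_gauge152R` (F0c's stub-1 fact + the datum-free (152) token, guard `Adm ⊓ floorGuard c`, gauge
  constant `B₉·B₃`), ★★ `variationalThm1GaugeRegSepCoP7MGB_of_prop8TopStepGB_of_prop6P_of_one_le` (F0c's stub-1 fact + [6] Prop. 6 on print's class, stub 2′'s `ρ₀ ≥ 1`: the whole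
  (9)-half of the ᴮ road in one call), and the sanity form `variationalThm1GaugeRegSepCoP7MG_of_gauge9TopStepG_via_GB` (the (b)-instance recovered through the GB road).
NOT HERE (they need S1a-C's `VariationalThm1RegSepTop7MGᴮ` ∕ `…CoP7MGᴮ` (the (8)-sentence for minimisers, `Record12BgRowCoClassCPMFloor′`) and, at the record, Stage 2's background):
the ROW BODIES `bgRowAtDatumU_of_thm1RegSepTop7MG_of_thm1GaugeG′`, `localGaugeOn_UbgMSCoPOfRecord_of_…′`, `bgRowAtDatumCoP_of_…′`, the Stage-13 lift `Stage13Params.bgAtDatumCoP_of_…′`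
— a sequel module.  `Record12BgRowCoClassGauge ∕ GaugeR ∕ GaugeRFloor ∕ GaugeRGuarded`, modules 20 ∕ 47 ∕ 51, F0a–F0c, S1b-1 are NOT edited.
HONEST SCOPE.  Definitions of named facts + binder-threading bookkeeping BY NAME + one Fermat step; nothing of [15] ∕ [6] asserted or proved; no (b)-instance fact is claimed false
(FLAG №16 concerns which instance print PROVES); antecedents OPEN, inhabited nowhere; K0⁷ stub 1 NOT closed; N07 NOT discharged; counts unmoved (typed 28∕28 · discharged 8∕28); one
finite 𝕋⁴ programme at fixed ε — the route closes the conditional finite-𝕋⁴ rung `BalabanLadder.UV` only; the YM mass gap (Clay) is NOT proved by any of this; nothing continuum ∕ ℝ⁴ ∕ OS.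
No `sorry`, no `instance`, no `notation`.

References: [15] (1) p.277, Thm 1 (2),(3),(5),(6),(7),(9) pp.278–279, p.299 («minimal configuration»), (144)–(152) pp.300–301, Prop. 8 p.304, p.304 lines 1–2; [6] (1.3)–(1.9) p.77,
Prop. 6 p.99, p.98; [II] (2.3) p.224; [III] (2.2) p.255, (2.6)–(2.8) pp.255–256, (2.10)–(2.13) p.256, (2.27)–(2.28) p.259, (2.38) p.261; [I] (0.1) p.251, (1.12) p.262.
-/

noncomputable section

open scoped Matrix.Norms.L2Operator
open scoped Topology

namespace Literature.MathematicalPhysics.QuantumFieldTheory.Balaban1983to89.Node00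

open T4Continuum B14.Eq218Concrete B15DeterminingSets B15DeterminingSetsB B12RegularSpaces111
open B8LeafModelZd (ZdIdx)

/-! ## §0  «Minimal ⇒ critical» over print's class (6) on a top domain, on a BOND-DATUM fibre -/

section MinimalCriticalTopB

variable {F : T4Family} {N : ℕ} [NeZero N]

/-- ★ **«MINIMAL ⇒ CRITICAL» OVER PRINT'S CLASS (6) ON A TOP DOMAIN, ON THE FIBRE OF ANY BOND DATUM `𝔅`** (module 20's `isCritOnFibre_of_isMinimizer_classTop` over `bd`; ANY
thresholds, any top domain `Ω₀`): a minimiser of (2.12) over the class on the fibre `{U ∣ Ū = W on 𝔅}` is a critical configuration of (5) on that fibre — a curve through it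
differentiable at `0` is continuous there, stays in the OPEN class (module 20's `eventually_mem_classTop`), and Fermat applies (F0b's `deriv_wilsonAction4_eq_zero_of_isMinimizerB`).
With `𝔅 := lamBondsSeq s.Ω k` (print's [II] (2.3) datum) this is exactly «the minimiser of (5) under (7) is a critical configuration», the hypothesis of [15] Prop. 8 as printed.
Print-datum twin of `isCritOnFibre_of_isMinimizer_classTop` (FLAG №16 ∕ LOCATE-HSEAM 5d3298b8d191f169); the (b)-instance stays landed and true on its own text.
[cite: Balaban1985Variational, (6) p.278, p.299, Prop. 8 p.304; Balaban1985RegularSpaces, (1.7)–(1.9) p.77; Balaban1988Convergent, (2.12) p.256; Balaban1984PropagatorsII, (2.3) p.224] -/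
theorem isCritOnFibreB_of_isMinimizerB_classTop {K k : ℕ} {Ω : ℕ → Set (Site (F.P K) 0)} {Ω₀ : Set (Site (F.P K) 0)} {r : ℕ → ℝ} {ε : ℝ}
    {𝔅 : BDetSet (F.P K)} {W : MSField (F.P K) (SU N)} {U₀ : GaugeField (F.P K) 0 (SU N)}
    (h : IsMinimizerB (avOfRecord F N K)
      {U | (∀ n, n ≤ k → PlaqSmallOn (Sect2.omegaPlaqsTop Ω Ω₀ n) (r n) U) ∧ Sect2.CoDivClassOnTop Ω Ω₀ k ε U} 𝔅 W U₀) :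
    IsCritOnFibreB F N K 𝔅 W U₀ := by
  intro γ h0 hd hc a ha
  have hγ : ContinuousAt (fun t (b : PBond (F.P K) 0) => γ t b) 0 := continuousAt_of_differentiableAt_val hd
  have hU : (∀ n, n ≤ k → PlaqSmallOn (Sect2.omegaPlaqsTop Ω Ω₀ n) (r n) (γ 0)) ∧ Sect2.CoDivClassOnTop Ω Ω₀ k ε (γ 0) := by
    rw [h0]
    exact h.1
  exact deriv_wilsonAction4_eq_zero_of_isMinimizerB h h0 (eventually_mem_classTop hγ hU) hc ha

end MinimalCriticalTopB

/-! ## §1  The guarded gauge sentence over `(bd, Dat)` — top-domain form -/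

section NamedFactGaugeTopMGB

variable (F : T4Family) (N : ℕ) [NeZero N]

/-- **[15] THEOREM 1 (9) LINE 1, ∃-GAUGE FORM, FOR THE MINIMISER ON A BOND-DATUM FIBRE WITH A TOP-DATA PREDICATE, GUARD-GENERIC** — module `…GaugeRGuarded` §1's
`VariationalThm1GaugeRegSepTop7MG F N Sup M Adm B₃ B₃' a₀ a₁` with the (7) row `Dat K s.Ω (Sup ν K s.Ω) k δ W` and the minimiser taken on the fibre of `bd K k s.Ω`
(`IsMinimizerB (avOfRecord F N K) {class (6)-Top at ε₀} (bd K k s.Ω) W U₀`); every other byte identical: at numerics with `M₁ ≥ 1`, at the prefixes passing `Adm`, cube letter `M`,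
for every such minimiser the local gauges of (9) line 1 at `B₃'·δ_n` on both grid-cube families inside `Ω_n`, `1 ≤ n ≤ k`.  Print-datum twin of `VariationalThm1GaugeRegSepTop7MG`
(FLAG №16 ∕ LOCATE-HSEAM 5d3298b8d191f169); the (b)-instance stays landed and true on its own text (`variationalThm1GaugeRegSepTop7MG_iff_GB`).  A `Prop` with parameters, NEVER asserted.
-- TODO(general form): as `…GaugeRGuarded` §1 (Hölder member and (10) not part of this sentence; ONE threshold ε₁ in print; general admissible `{Ω_j}`; print's `R ≥ R₁`, `M` a multiple of `R₁M₁`).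
[cite: Balaban1985Variational, (1) p.277, Thm 1 (2),(3),(5),(6),(7),(9) pp.278–279, (144)–(152) pp.300–301, p.304 lines 1–2; Balaban1985RegularSpaces, (1.3)–(1.9) p.77, Prop. 6 p.99; Balaban1988Convergent, (2.6)–(2.8) pp.255–256, (2.12)–(2.13) p.256, (2.38) p.261; Balaban1984PropagatorsII, (2.3) p.224; Balaban1987RG1, (0.1) p.251, (1.12) p.262] -/
def VariationalThm1GaugeRegSepTop7MGB (Sup : (ν : Stage7Numerics) → (K : ℕ) → (ℕ → Set (Site (F.P K) 0)) → Set (Site (F.P K) 0)) (M : ℕ) (Adm : StepGuard F)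
    (bd : BondDatum F) (Dat : TopData F N) (B₃ B₃' a₀ a₁ : ℝ) : Prop :=
  ∀ (ν : Stage7Numerics) (g : ℕ → ℝ) (K k : ℕ) (s : SeqOfRecord F ν M g K k), Sect2.SeqSeparated ν.M₁ s → 0 < ν.M₁ → Adm ν M g K k s → ∀ (ε₀ : ℝ) (δ : ℕ → ℝ),
    (∀ n, n ≤ k → 0 < δ n ∧ δ n ≤ a₁ ∧ B₃ * δ n ≤ ε₀) → (∀ n, n < k → δ n ≤ 2 * δ (n + 1)) → (∀ n, n < k → δ (n + 1) ≤ 2 * δ n) → ε₀ ≤ a₀ →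
    ∀ W : MSField (F.P K) (SU N), Dat K s.Ω (Sup ν K s.Ω) k δ W →
      ∀ U₀, IsMinimizerB (avOfRecord F N K)
          {U | (∀ n, n ≤ k → PlaqSmallOn (Sect2.omegaPlaqsTop s.Ω (Sup ν K s.Ω) n) (ε₀ * (F.P K).eta n ^ 2) U) ∧
            Sect2.CoDivClassOnTop s.Ω (Sup ν K s.Ω) k ε₀ U} (bd K k s.Ω) W U₀ →
        ∀ n, 1 ≤ n → n ≤ k →
          (((B14.Eq213MaximalDomains.side (F.P K).L M n : ℕ) : ℤ) < (F.P K).sitesPerDir 0 →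
            ∀ a ∈ cubeIndices (F.P K) (B14.Eq213MaximalDomains.side (F.P K).L M n),
              cubeEnl (F.P K) (B14.Eq213MaximalDomains.side (F.P K).L M n) a 0 ⊆ s.Ω n →
              Sect2.LocalGaugeOn (cubeEnl (F.P K) (B14.Eq213MaximalDomains.side (F.P K).L M n) a 0) ((F.P K).eta n) (B₃' * δ n) U₀) ∧
          (((B14.Eq213MaximalDomains.side (F.P K).L M (n + 1) : ℕ) : ℤ) < (F.P K).sitesPerDir 0 →
            ∀ a ∈ cubeIndices (F.P K) (B14.Eq213MaximalDomains.side (F.P K).L M (n + 1)),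
              cubeEnl (F.P K) (B14.Eq213MaximalDomains.side (F.P K).L M (n + 1)) a 0 ⊆ s.Ω n →
              Sect2.LocalGaugeOn (cubeEnl (F.P K) (B14.Eq213MaximalDomains.side (F.P K).L M (n + 1)) a 0) ((F.P K).eta n) (B₃' * δ n) U₀)

variable {F N}

/-- ★ Module `…GaugeRGuarded` §1's `VariationalThm1GaugeRegSepTop7MG` IS the instance `(genSetDatum F) (dataSmall7PTopOf F N)` — definitionally (`IsMinimizer … 𝔹 = IsMinimizerB … (bondsDet 𝔹)`
is `rfl`). [cite: Balaban1985Variational, Thm 1 (9) p.279; Balaban1988Convergent, (2.10), (2.12) p.256; Balaban1987RG1, (0.1) p.251] -/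
theorem variationalThm1GaugeRegSepTop7MG_iff_GB {Sup : (ν : Stage7Numerics) → (K : ℕ) → (ℕ → Set (Site (F.P K) 0)) → Set (Site (F.P K) 0)} {M : ℕ} {Adm : StepGuard F}
    {B₃ B₃' a₀ a₁ : ℝ} :
    VariationalThm1GaugeRegSepTop7MG F N Sup M Adm B₃ B₃' a₀ a₁ ↔ VariationalThm1GaugeRegSepTop7MGB F N Sup M Adm (genSetDatum F) (dataSmall7PTopOf F N) B₃ B₃' a₀ a₁ :=
  Iff.rfl

/-- dag-n21-c's floor-carrying R sentence IS the instance `(floorGuard F c) (genSetDatum F) (dataSmall7PTopOf F N)`, definitionally.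
[cite: Balaban1985RegularSpaces, (1.3)–(1.6) p.77; Balaban1985Variational, p.304 lines 1–2 (bookkeeping); Balaban1988Convergent, (2.10) p.256] -/
theorem variationalThm1GaugeRegSepTop7MR_iff_GB_floorGuard {Sup : (ν : Stage7Numerics) → (K : ℕ) → (ℕ → Set (Site (F.P K) 0)) → Set (Site (F.P K) 0)} {M c : ℕ}
    {B₃ B₃' a₀ a₁ : ℝ} :
    VariationalThm1GaugeRegSepTop7MR F N Sup M c B₃ B₃' a₀ a₁ ↔ VariationalThm1GaugeRegSepTop7MGB F N Sup M (floorGuard F c) (genSetDatum F) (dataSmall7PTopOf F N) B₃ B₃' a₀ a₁ :=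
  Iff.rfl

/-- The guarded gauge sentence over `(bd, Dat)` is ANTITONE in `a₀`, `a₁`. [cite: Balaban1985Variational, Thm 1 p.279 (the range «ε₀ ≤ a₀», «ε₁ ≤ a₁»)] -/
theorem VariationalThm1GaugeRegSepTop7MGB.of_le {Sup : (ν : Stage7Numerics) → (K : ℕ) → (ℕ → Set (Site (F.P K) 0)) → Set (Site (F.P K) 0)} {M : ℕ} {Adm : StepGuard F}
    {bd : BondDatum F} {Dat : TopData F N} {B₃ B₃' a₀ a₀' a₁ a₁' : ℝ} (h : VariationalThm1GaugeRegSepTop7MGB F N Sup M Adm bd Dat B₃ B₃' a₀ a₁) (ha₀ : a₀' ≤ a₀) (ha₁ : a₁' ≤ a₁) :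
    VariationalThm1GaugeRegSepTop7MGB F N Sup M Adm bd Dat B₃ B₃' a₀' a₁' :=
  fun ν g K k s hsep hM₁ hadm ε₀ δ hnum hcomp hcomp' hε W h7 U₀ hmin =>
    h ν g K k s hsep hM₁ hadm ε₀ δ (fun n hn => ⟨(hnum n hn).1, (hnum n hn).2.1.trans ha₁, (hnum n hn).2.2⟩) hcomp hcomp' (hε.trans ha₀) W h7 U₀ hmin

/-- The guarded gauge sentence over `(bd, Dat)` is MONOTONE in the gauge constant `B₃'`. [cite: Balaban1985Variational, Thm 1 (9) p.279 (bookkeeping)] -/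
theorem VariationalThm1GaugeRegSepTop7MGB.mono {Sup : (ν : Stage7Numerics) → (K : ℕ) → (ℕ → Set (Site (F.P K) 0)) → Set (Site (F.P K) 0)} {M : ℕ} {Adm : StepGuard F}
    {bd : BondDatum F} {Dat : TopData F N} {B₃ B₃' B₃'' a₀ a₁ : ℝ} (h : VariationalThm1GaugeRegSepTop7MGB F N Sup M Adm bd Dat B₃ B₃' a₀ a₁) (hB : B₃' ≤ B₃'') :
    VariationalThm1GaugeRegSepTop7MGB F N Sup M Adm bd Dat B₃ B₃'' a₀ a₁ := by
  intro ν g K k s hsep hM₁ hadm ε₀ δ hnum hcomp hcomp' hε W h7 U₀ hmin n hn1 hnk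
  have hδ : B₃' * δ n ≤ B₃'' * δ n := mul_le_mul_of_nonneg_right hB (hnum n hnk).1.le
  obtain ⟨hMS, hI⟩ := h ν g K k s hsep hM₁ hadm ε₀ δ hnum hcomp hcomp' hε W h7 U₀ hmin n hn1 hnk
  exact ⟨fun hsN a ha hΩ => (hMS hsN a ha hΩ).of_le hδ, fun hsN a ha hΩ => (hI hsN a ha hΩ).of_le hδ⟩

/-- ANTITONE IN THE GUARD: a stronger guard asks the sentence of fewer prefixes. [cite: Balaban1985Variational, Thm 1 (9) p.279; Balaban1987RG1, (0.1) p.251 (bookkeeping)] -/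
theorem VariationalThm1GaugeRegSepTop7MGB.of_imp {Sup : (ν : Stage7Numerics) → (K : ℕ) → (ℕ → Set (Site (F.P K) 0)) → Set (Site (F.P K) 0)} {M : ℕ} {Adm Adm' : StepGuard F}
    {bd : BondDatum F} {Dat : TopData F N} {B₃ B₃' a₀ a₁ : ℝ} (h : VariationalThm1GaugeRegSepTop7MGB F N Sup M Adm bd Dat B₃ B₃' a₀ a₁)
    (himp : ∀ ν M g K k s, Adm' ν M g K k s → Adm ν M g K k s) : VariationalThm1GaugeRegSepTop7MGB F N Sup M Adm' bd Dat B₃ B₃' a₀ a₁ :=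
  fun ν g K k s hsep hM₁ hadm' => h ν g K k s hsep hM₁ (himp ν M g K k s hadm')

/-- ANTITONE IN THE DATA PREDICATE: a WEAKER data hypothesis `Dat′ ⇒ Dat` pointwise gives a STRONGER sentence (F0c's `.of_imp_dat` shape).
[cite: Balaban1985Variational, (7) p.278, Thm 1 (9) p.279 (bookkeeping)] -/
theorem VariationalThm1GaugeRegSepTop7MGB.of_imp_dat {Sup : (ν : Stage7Numerics) → (K : ℕ) → (ℕ → Set (Site (F.P K) 0)) → Set (Site (F.P K) 0)} {M : ℕ} {Adm : StepGuard F}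
    {bd : BondDatum F} {Dat Dat' : TopData F N} {B₃ B₃' a₀ a₁ : ℝ} (h : VariationalThm1GaugeRegSepTop7MGB F N Sup M Adm bd Dat B₃ B₃' a₀ a₁)
    (himp : ∀ (K : ℕ) (Ω : ℕ → Set (Site (F.P K) 0)) (Ω₀ : Set (Site (F.P K) 0)) (k : ℕ) (δ : ℕ → ℝ) (W : MSField (F.P K) (SU N)), Dat' K Ω Ω₀ k δ W → Dat K Ω Ω₀ k δ W) :
    VariationalThm1GaugeRegSepTop7MGB F N Sup M Adm bd Dat' B₃ B₃' a₀ a₁ :=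
  fun ν g K k s hsep hM₁ hadm ε₀ δ hnum hcomp hcomp' hε W h7 => h ν g K k s hsep hM₁ hadm ε₀ δ hnum hcomp hcomp' hε W (himp _ _ _ _ _ _ h7)

/-- Guards compose by conjunction (right factor added). [cite: Balaban1985Variational, Thm 1 (9) p.279 (bookkeeping)] -/
theorem VariationalThm1GaugeRegSepTop7MGB.and_right {Sup : (ν : Stage7Numerics) → (K : ℕ) → (ℕ → Set (Site (F.P K) 0)) → Set (Site (F.P K) 0)} {M : ℕ} {Adm₁ Adm₂ : StepGuard F}
    {bd : BondDatum F} {Dat : TopData F N} {B₃ B₃' a₀ a₁ : ℝ} (h : VariationalThm1GaugeRegSepTop7MGB F N Sup M Adm₁ bd Dat B₃ B₃' a₀ a₁) :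
    VariationalThm1GaugeRegSepTop7MGB F N Sup M (fun ν M g K k s => Adm₁ ν M g K k s ∧ Adm₂ ν M g K k s) bd Dat B₃ B₃' a₀ a₁ :=
  h.of_imp fun _ _ _ _ _ _ h' => h'.1

/-- Guards compose by conjunction (left factor added). [cite: Balaban1985Variational, Thm 1 (9) p.279 (bookkeeping)] -/
theorem VariationalThm1GaugeRegSepTop7MGB.and_left {Sup : (ν : Stage7Numerics) → (K : ℕ) → (ℕ → Set (Site (F.P K) 0)) → Set (Site (F.P K) 0)} {M : ℕ} {Adm₁ Adm₂ : StepGuard F}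
    {bd : BondDatum F} {Dat : TopData F N} {B₃ B₃' a₀ a₁ : ℝ} (h : VariationalThm1GaugeRegSepTop7MGB F N Sup M Adm₂ bd Dat B₃ B₃' a₀ a₁) :
    VariationalThm1GaugeRegSepTop7MGB F N Sup M (fun ν M g K k s => Adm₁ ν M g K k s ∧ Adm₂ ν M g K k s) bd Dat B₃ B₃' a₀ a₁ :=
  h.of_imp fun _ _ _ _ _ _ h' => h'.2

/-- node00-def-P11's FLOOR-FREE (b)-sentence is the trivial-guard instance at `(genSetDatum F, dataSmall7PTopOf F N)` (via `…GaugeRGuarded`'s `…_top_iff`).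
[cite: Balaban1985Variational, Thm 1 (9) p.279 (bookkeeping); Balaban1988Convergent, (2.10) p.256] -/
theorem variationalThm1GaugeRegSepTop7M_iff_GB_top {Sup : (ν : Stage7Numerics) → (K : ℕ) → (ℕ → Set (Site (F.P K) 0)) → Set (Site (F.P K) 0)} {M : ℕ} {B₃ B₃' a₀ a₁ : ℝ} :
    VariationalThm1GaugeRegSepTop7M F N Sup M B₃ B₃' a₀ a₁ ↔
      VariationalThm1GaugeRegSepTop7MGB F N Sup M (fun _ _ _ _ _ _ => True) (genSetDatum F) (dataSmall7PTopOf F N) B₃ B₃' a₀ a₁ :=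
  variationalThm1GaugeRegSepTop7MG_top_iff.symm

/-- A floor-carrying (b)-instance R sentence serves every guard implying its floor, at `(genSetDatum F, dataSmall7PTopOf F N)`.
[cite: Balaban1985RegularSpaces, (1.3)–(1.6) p.77; Balaban1985Variational, p.304 lines 1–2 (bookkeeping)] -/
theorem VariationalThm1GaugeRegSepTop7MR.toGB_of_imp_floor {Sup : (ν : Stage7Numerics) → (K : ℕ) → (ℕ → Set (Site (F.P K) 0)) → Set (Site (F.P K) 0)} {M c : ℕ}
    {Adm : StepGuard F} {B₃ B₃' a₀ a₁ : ℝ} (h : VariationalThm1GaugeRegSepTop7MR F N Sup M c B₃ B₃' a₀ a₁) (himp : ∀ ν M g K k s, Adm ν M g K k s → c ≤ ν.M₁) :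
    VariationalThm1GaugeRegSepTop7MGB F N Sup M Adm (genSetDatum F) (dataSmall7PTopOf F N) B₃ B₃' a₀ a₁ :=
  (variationalThm1GaugeRegSepTop7MR_iff_GB_floorGuard.1 h).of_imp himp

/-- **EVERY MINIMISER OVER THE TOP-DOMAIN CLASS (6) ON A `bd`-FIBRE AT A PREFIX PASSING THE GUARD CARRIES THE LOCAL GAUGES OF (9) LINE 1 AT THRESHOLD `B₃'·cR·ε_n` ON BOTH CUBE
FAMILIES INSIDE `Ω_n`, `1 ≤ n ≤ k`** — `…GaugeRGuarded` §2's `localGaugeOn_of_thm1GaugeRegSepTop7MG` over `(bd, Dat)` (application of the sentence at the record's radii letters).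
[cite: Balaban1985Variational, Thm 1 (2),(6),(7),(9) pp.278–279; Balaban1985RegularSpaces, (1.3) p.77; Balaban1988Convergent, (2.6)–(2.8) pp.255–256, (2.12)–(2.13) p.256, (2.38) p.261; Balaban1987RG1, (0.1) p.251] -/
theorem localGaugeOn_of_thm1GaugeRegSepTop7MGB {Sup : (ν : Stage7Numerics) → (K : ℕ) → (ℕ → Set (Site (F.P K) 0)) → Set (Site (F.P K) 0)} {M : ℕ} {Adm : StepGuard F}
    {bd : BondDatum F} {Dat : TopData F N} {B₃ B₃' a₀ a₁ : ℝ} (h15G : VariationalThm1GaugeRegSepTop7MGB F N Sup M Adm bd Dat B₃ B₃' a₀ a₁) (ν : Stage7Numerics)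
    (g : ℕ → ℝ) (K k : ℕ) (cR : ℝ) (s : SeqOfRecord F ν M g K k) (hsep : Sect2.SeqSeparated ν.M₁ s) (hM₁ : 0 < ν.M₁) (hadm : Adm ν M g K k s)
    (hnum : ∀ n, n ≤ k → 0 < cR * epsOfRecord ν g n ∧ cR * epsOfRecord ν g n ≤ a₁ ∧ B₃ * (cR * epsOfRecord ν g n) ≤ ν.εreg) (ha₀ : ν.εreg ≤ a₀)
    (hcomp : ∀ n, n < k → cR * epsOfRecord ν g n ≤ 2 * (cR * epsOfRecord ν g (n + 1)))
    (hcomp' : ∀ n, n < k → cR * epsOfRecord ν g (n + 1) ≤ 2 * (cR * epsOfRecord ν g n))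
    {W : MSField (F.P K) (SU N)} (h7 : Dat K s.Ω (Sup ν K s.Ω) k (fun n => cR * epsOfRecord ν g n) W)
    {U₀ : GaugeField (F.P K) 0 (SU N)} (hmin : IsMinimizerB (avOfRecord F N K)
      {U | (∀ n, n ≤ k → PlaqSmallOn (Sect2.omegaPlaqsTop s.Ω (Sup ν K s.Ω) n) (ν.εreg * (F.P K).eta n ^ 2) U) ∧
        Sect2.CoDivClassOnTop s.Ω (Sup ν K s.Ω) k ν.εreg U} (bd K k s.Ω) W U₀) :
    ∀ n, 1 ≤ n → n ≤ k →
      (((B14.Eq213MaximalDomains.side (F.P K).L M n : ℕ) : ℤ) < (F.P K).sitesPerDir 0 →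
        ∀ a ∈ cubeIndices (F.P K) (B14.Eq213MaximalDomains.side (F.P K).L M n),
          cubeEnl (F.P K) (B14.Eq213MaximalDomains.side (F.P K).L M n) a 0 ⊆ s.Ω n →
          Sect2.LocalGaugeOn (cubeEnl (F.P K) (B14.Eq213MaximalDomains.side (F.P K).L M n) a 0) ((F.P K).eta n) (B₃' * (cR * epsOfRecord ν g n)) U₀) ∧
      (((B14.Eq213MaximalDomains.side (F.P K).L M (n + 1) : ℕ) : ℤ) < (F.P K).sitesPerDir 0 →
        ∀ a ∈ cubeIndices (F.P K) (B14.Eq213MaximalDomains.side (F.P K).L M (n + 1)),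
          cubeEnl (F.P K) (B14.Eq213MaximalDomains.side (F.P K).L M (n + 1)) a 0 ⊆ s.Ω n →
          Sect2.LocalGaugeOn (cubeEnl (F.P K) (B14.Eq213MaximalDomains.side (F.P K).L M (n + 1)) a 0) ((F.P K).eta n) (B₃' * (cR * epsOfRecord ν g n)) U₀) :=
  h15G ν g K k s hsep hM₁ hadm ν.εreg (fun n => cR * epsOfRecord ν g n) hnum hcomp hcomp' ha₀ W h7 U₀ hmin

end NamedFactGaugeTopMGB

/-! ## §2  The guarded gauge sentence over `(bd, Dat)` AT THE SUPPORT OF RECORD -/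

section AtRecordGaugeCoPMGB

variable (F : T4Family) (N : ℕ) [NeZero N]

/-- **[15] THEOREM 1 (9) LINE 1 IN ∃-GAUGE FORM FOR THE MINIMISER ON A `bd`-FIBRE WITH THE DATA PREDICATE `Dat`, ON THE SUPPORT OF RECORD `suppDomOfRecord`, `M₁ ≥ 1`, PREFIX GUARD
`Adm`, CUBE LETTER `M`**: §1's `VariationalThm1GaugeRegSepTop7MGB` at `Sup := suppDomOfRecord` (definitional).  Print-datum twin of `VariationalThm1GaugeRegSepCoP7MG` (FLAG №16 ∕
LOCATE-HSEAM 5d3298b8d191f169); the (b)-instance stays landed and true on its own text (`variationalThm1GaugeRegSepCoP7MG_iff_GB`).  A `Prop` with parameters, NEVER asserted. -- TODO(general form): as §1.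
[cite: Balaban1985Variational, (1) p.277, Thm 1 (2),(3),(5),(6),(7),(9) pp.278–279, (144)–(152) pp.300–301, p.304 lines 1–2; Balaban1985RegularSpaces, (1.3)–(1.9) p.77, Prop. 6 p.99; Balaban1988Convergent, (2.6)–(2.8) pp.255–256, (2.12)–(2.13) p.256, (2.38) p.261; Balaban1984PropagatorsII, (2.3) p.224; Balaban1987RG1, (0.1) p.251] -/
def VariationalThm1GaugeRegSepCoP7MGB (M : ℕ) (Adm : StepGuard F) (bd : BondDatum F) (Dat : TopData F N) (B₃ B₃' a₀ a₁ : ℝ) : Prop :=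
  VariationalThm1GaugeRegSepTop7MGB F N (fun ν K Ω => suppDomOfRecord F ν K Ω) M Adm bd Dat B₃ B₃' a₀ a₁

variable {F N}

/-- Definitional bridge to the guarded top-domain sentence over `(bd, Dat)` at the selector of record. [cite: Balaban1985Variational, Thm 1 (9) p.279 (bookkeeping)] -/
theorem VariationalThm1GaugeRegSepCoP7MGB.toTop7MGB {M : ℕ} {Adm : StepGuard F} {bd : BondDatum F} {Dat : TopData F N} {B₃ B₃' a₀ a₁ : ℝ}
    (h : VariationalThm1GaugeRegSepCoP7MGB F N M Adm bd Dat B₃ B₃' a₀ a₁) :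
    VariationalThm1GaugeRegSepTop7MGB F N (fun ν K Ω => suppDomOfRecord F ν K Ω) M Adm bd Dat B₃ B₃' a₀ a₁ := h

/-- Conversely (definitional). [cite: Balaban1985Variational, Thm 1 (9) p.279 (bookkeeping)] -/
theorem VariationalThm1GaugeRegSepTop7MGB.toCoP7MGB {M : ℕ} {Adm : StepGuard F} {bd : BondDatum F} {Dat : TopData F N} {B₃ B₃' a₀ a₁ : ℝ}
    (h : VariationalThm1GaugeRegSepTop7MGB F N (fun ν K Ω => suppDomOfRecord F ν K Ω) M Adm bd Dat B₃ B₃' a₀ a₁) :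
    VariationalThm1GaugeRegSepCoP7MGB F N M Adm bd Dat B₃ B₃' a₀ a₁ := h

/-- ★ Module `…GaugeRGuarded` §3's `VariationalThm1GaugeRegSepCoP7MG` IS the instance `(genSetDatum F) (dataSmall7PTopOf F N)`, definitionally.
[cite: Balaban1985Variational, Thm 1 (9) p.279; Balaban1988Convergent, (2.10), (2.12) p.256; Balaban1987RG1, (0.1) p.251] -/
theorem variationalThm1GaugeRegSepCoP7MG_iff_GB {M : ℕ} {Adm : StepGuard F} {B₃ B₃' a₀ a₁ : ℝ} :
    VariationalThm1GaugeRegSepCoP7MG F N M Adm B₃ B₃' a₀ a₁ ↔ VariationalThm1GaugeRegSepCoP7MGB F N M Adm (genSetDatum F) (dataSmall7PTopOf F N) B₃ B₃' a₀ a₁ :=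
  Iff.rfl

/-- dag-n21-c's floor-carrying R `CoP` sentence IS the instance `(floorGuard F c) (genSetDatum F) (dataSmall7PTopOf F N)`, definitionally (what S1d's R-keyed consumers instantiate).
[cite: Balaban1985RegularSpaces, (1.3)–(1.6) p.77; Balaban1985Variational, p.304 lines 1–2 (bookkeeping); Balaban1988Convergent, (2.10) p.256] -/
theorem variationalThm1GaugeRegSepCoP7MR_iff_GB_floorGuard {M c : ℕ} {B₃ B₃' a₀ a₁ : ℝ} :
    VariationalThm1GaugeRegSepCoP7MR F N M c B₃ B₃' a₀ a₁ ↔ VariationalThm1GaugeRegSepCoP7MGB F N M (floorGuard F c) (genSetDatum F) (dataSmall7PTopOf F N) B₃ B₃' a₀ a₁ :=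
  Iff.rfl

/-- node00-def-P11's floor-free `CoP` (b)-sentence is the trivial-guard instance at `(genSetDatum F, dataSmall7PTopOf F N)`. [cite: Balaban1985Variational, Thm 1 (9) p.279 (bookkeeping); Balaban1988Convergent, (2.10) p.256] -/
theorem variationalThm1GaugeRegSepCoP7M_iff_GB_top {M : ℕ} {B₃ B₃' a₀ a₁ : ℝ} :
    VariationalThm1GaugeRegSepCoP7M F N M B₃ B₃' a₀ a₁ ↔
      VariationalThm1GaugeRegSepCoP7MGB F N M (fun _ _ _ _ _ _ => True) (genSetDatum F) (dataSmall7PTopOf F N) B₃ B₃' a₀ a₁ :=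
  variationalThm1GaugeRegSepTop7M_iff_GB_top

/-- The guarded gauge `CoP` sentence over `(bd, Dat)` is ANTITONE in `a₀`, `a₁`. [cite: Balaban1985Variational, Thm 1 p.279 (the range «ε₀ ≤ a₀», «ε₁ ≤ a₁»)] -/
theorem VariationalThm1GaugeRegSepCoP7MGB.of_le {M : ℕ} {Adm : StepGuard F} {bd : BondDatum F} {Dat : TopData F N} {B₃ B₃' a₀ a₀' a₁ a₁' : ℝ}
    (h : VariationalThm1GaugeRegSepCoP7MGB F N M Adm bd Dat B₃ B₃' a₀ a₁) (ha₀ : a₀' ≤ a₀) (ha₁ : a₁' ≤ a₁) :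
    VariationalThm1GaugeRegSepCoP7MGB F N M Adm bd Dat B₃ B₃' a₀' a₁' :=
  VariationalThm1GaugeRegSepTop7MGB.of_le h ha₀ ha₁

/-- The guarded gauge `CoP` sentence over `(bd, Dat)` is MONOTONE in `B₃'`. [cite: Balaban1985Variational, Thm 1 (9) p.279 (bookkeeping)] -/
theorem VariationalThm1GaugeRegSepCoP7MGB.mono {M : ℕ} {Adm : StepGuard F} {bd : BondDatum F} {Dat : TopData F N} {B₃ B₃' B₃'' a₀ a₁ : ℝ}
    (h : VariationalThm1GaugeRegSepCoP7MGB F N M Adm bd Dat B₃ B₃' a₀ a₁) (hB : B₃' ≤ B₃'') : VariationalThm1GaugeRegSepCoP7MGB F N M Adm bd Dat B₃ B₃'' a₀ a₁ :=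
  VariationalThm1GaugeRegSepTop7MGB.mono h hB

/-- The guarded gauge `CoP` sentence over `(bd, Dat)` is ANTITONE in the guard. [cite: Balaban1985Variational, Thm 1 (9) p.279; Balaban1987RG1, (0.1) p.251 (bookkeeping)] -/
theorem VariationalThm1GaugeRegSepCoP7MGB.of_imp {M : ℕ} {Adm Adm' : StepGuard F} {bd : BondDatum F} {Dat : TopData F N} {B₃ B₃' a₀ a₁ : ℝ}
    (h : VariationalThm1GaugeRegSepCoP7MGB F N M Adm bd Dat B₃ B₃' a₀ a₁) (himp : ∀ ν M g K k s, Adm' ν M g K k s → Adm ν M g K k s) :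
    VariationalThm1GaugeRegSepCoP7MGB F N M Adm' bd Dat B₃ B₃' a₀ a₁ :=
  VariationalThm1GaugeRegSepTop7MGB.of_imp h himp

/-- The guarded gauge `CoP` sentence over `(bd, Dat)` is ANTITONE in the data predicate. [cite: Balaban1985Variational, (7) p.278, Thm 1 (9) p.279 (bookkeeping)] -/
theorem VariationalThm1GaugeRegSepCoP7MGB.of_imp_dat {M : ℕ} {Adm : StepGuard F} {bd : BondDatum F} {Dat Dat' : TopData F N} {B₃ B₃' a₀ a₁ : ℝ}
    (h : VariationalThm1GaugeRegSepCoP7MGB F N M Adm bd Dat B₃ B₃' a₀ a₁)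
    (himp : ∀ (K : ℕ) (Ω : ℕ → Set (Site (F.P K) 0)) (Ω₀ : Set (Site (F.P K) 0)) (k : ℕ) (δ : ℕ → ℝ) (W : MSField (F.P K) (SU N)), Dat' K Ω Ω₀ k δ W → Dat K Ω Ω₀ k δ W) :
    VariationalThm1GaugeRegSepCoP7MGB F N M Adm bd Dat' B₃ B₃' a₀ a₁ :=
  VariationalThm1GaugeRegSepTop7MGB.of_imp_dat h himp

/-- Guards compose by conjunction (`CoP`, right factor added). [cite: Balaban1985Variational, Thm 1 (9) p.279 (bookkeeping)] -/
theorem VariationalThm1GaugeRegSepCoP7MGB.and_right {M : ℕ} {Adm₁ Adm₂ : StepGuard F} {bd : BondDatum F} {Dat : TopData F N} {B₃ B₃' a₀ a₁ : ℝ}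
    (h : VariationalThm1GaugeRegSepCoP7MGB F N M Adm₁ bd Dat B₃ B₃' a₀ a₁) :
    VariationalThm1GaugeRegSepCoP7MGB F N M (fun ν M g K k s => Adm₁ ν M g K k s ∧ Adm₂ ν M g K k s) bd Dat B₃ B₃' a₀ a₁ :=
  VariationalThm1GaugeRegSepTop7MGB.and_right h

/-- Guards compose by conjunction (`CoP`, left factor added). [cite: Balaban1985Variational, Thm 1 (9) p.279 (bookkeeping)] -/
theorem VariationalThm1GaugeRegSepCoP7MGB.and_left {M : ℕ} {Adm₁ Adm₂ : StepGuard F} {bd : BondDatum F} {Dat : TopData F N} {B₃ B₃' a₀ a₁ : ℝ}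
    (h : VariationalThm1GaugeRegSepCoP7MGB F N M Adm₂ bd Dat B₃ B₃' a₀ a₁) :
    VariationalThm1GaugeRegSepCoP7MGB F N M (fun ν M g K k s => Adm₁ ν M g K k s ∧ Adm₂ ν M g K k s) bd Dat B₃ B₃' a₀ a₁ :=
  VariationalThm1GaugeRegSepTop7MGB.and_left h

/-- A floor-carrying (b)-instance R `CoP` sentence serves every guard implying its floor, at `(genSetDatum F, dataSmall7PTopOf F N)`.
[cite: Balaban1985RegularSpaces, (1.3)–(1.6) p.77 (bookkeeping); Balaban1988Convergent, (2.10) p.256] -/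
theorem VariationalThm1GaugeRegSepCoP7MR.toGB_of_imp_floor {M c : ℕ} {Adm : StepGuard F} {B₃ B₃' a₀ a₁ : ℝ} (h : VariationalThm1GaugeRegSepCoP7MR F N M c B₃ B₃' a₀ a₁)
    (himp : ∀ ν M g K k s, Adm ν M g K k s → c ≤ ν.M₁) : VariationalThm1GaugeRegSepCoP7MGB F N M Adm (genSetDatum F) (dataSmall7PTopOf F N) B₃ B₃' a₀ a₁ :=
  (variationalThm1GaugeRegSepCoP7MR_iff_GB_floorGuard.1 h).of_imp himp

end AtRecordGaugeCoPMGB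

/-! ## §3  The guarded gauge sentence over `(bd, Dat)` FROM S1b-1's step token `Gauge9RegSepTopStepGB` — minimal ⇒ critical on the `bd`-fibre -/

section FromStepGB

variable {F : T4Family} {N : ℕ} [NeZero N]

/-- ★ **THE GUARDED GAUGE TOP-DOMAIN SENTENCE OVER `(bd, Dat)` FROM THE GUARDED STEP TOKEN OVER THE SAME `(bd, Dat)`**: S1b-1's `Gauge9RegSepTopStepGB F N Sup M Adm bd Dat B₃ B₃' a₀ a₁`
([15] Sect. F for (9) line 1 at the objects of record, for configurations in class (6)-Top CRITICAL on the `bd`-fibre, `1 ≤ k`, at prefixes passing `Adm`) gives §1's sentence for every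
MINIMISER on the `bd`-fibre — minimal over the open class ⇒ critical on the fibre (§0), and a minimiser AGREES with the data on `bd` (`IsMinimizerB`'s second field).  Module
`…GaugeRGuarded` §4's term with the rows threaded. [cite: Balaban1985Variational, Thm 1 (9) p.279, p.299, p.300, Prop. 8 p.304, (152) p.301, (167)–(169) pp.304–305; Balaban1988Convergent, (2.12)–(2.13) p.256; Balaban1984PropagatorsII, (2.3) p.224; Balaban1987RG1, (0.1) p.251] -/
theorem variationalThm1GaugeRegSepTop7MGB_of_gauge9TopStepGB {Sup : (ν : Stage7Numerics) → (K : ℕ) → (ℕ → Set (Site (F.P K) 0)) → Set (Site (F.P K) 0)} {M : ℕ}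
    {Adm : StepGuard F} {bd : BondDatum F} {Dat : TopData F N} {B₃ B₃' a₀ a₁ : ℝ} (h9 : Gauge9RegSepTopStepGB F N Sup M Adm bd Dat B₃ B₃' a₀ a₁) :
    VariationalThm1GaugeRegSepTop7MGB F N Sup M Adm bd Dat B₃ B₃' a₀ a₁ :=
  fun ν g K k s hsep hM₁ hadm ε₀ δ hδ hcomp hcomp' hε₀ W h7 U₀ hU₀ _ hn1 hnk =>
    ⟨fun hSN a ha hΩ => h9 ν g K k s hsep hM₁ hadm (hn1.trans hnk) ε₀ δ hδ hcomp hcomp' hε₀ W h7 U₀ hU₀.1.1 hU₀.1.2 hU₀.2.1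
        (isCritOnFibreB_of_isMinimizerB_classTop hU₀) _ hn1 hnk _ (Or.inl rfl) hSN a ha hΩ,
     fun hSN a ha hΩ => h9 ν g K k s hsep hM₁ hadm (hn1.trans hnk) ε₀ δ hδ hcomp hcomp' hε₀ W h7 U₀ hU₀.1.1 hU₀.1.2 hU₀.2.1
        (isCritOnFibreB_of_isMinimizerB_classTop hU₀) _ hn1 hnk _ (Or.inr rfl) hSN a ha hΩ⟩

/-- ★ **THE GUARDED GAUGE `CoP` SENTENCE OVER `(bd, Dat)` FROM THE GUARDED STEP TOKEN** at def-R's support selector (definitional).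
[cite: Balaban1985Variational, Thm 1 (9) p.279, Prop. 8 p.304, (152) p.301; Balaban1984PropagatorsII, (2.3) p.224; Balaban1987RG1, (0.1) p.251] -/
theorem variationalThm1GaugeRegSepCoP7MGB_of_gauge9TopStepGB {M : ℕ} {Adm : StepGuard F} {bd : BondDatum F} {Dat : TopData F N} {B₃ B₃' a₀ a₁ : ℝ}
    (h9 : Gauge9RegSepTopStepGB F N (fun ν K Ω => suppDomOfRecord F ν K Ω) M Adm bd Dat B₃ B₃' a₀ a₁) :
    VariationalThm1GaugeRegSepCoP7MGB F N M Adm bd Dat B₃ B₃' a₀ a₁ :=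
  (variationalThm1GaugeRegSepTop7MGB_of_gauge9TopStepGB h9).toCoP7MGB

/-- ★ **THE GUARDED GAUGE `CoP` SENTENCE OVER `(bd, Dat)` FROM F0c's STUB-1 FACT OVER `(bd, Dat)` AND THE DATUM-FREE (152) TOKEN AT FLOOR `c`** (the (9)-half of the ᴮ road in one
call): `Prop8RegSepTopStepGB … Adm bd Dat …` with FILE 29's `Gauge152OfClassTopStepR … M c …` gives, by S1b-1's `gauge9GB_of_prop8TopStepGB_of_gauge152R` and this §3, the (9) `CoP`
sentence under the guard `Adm ⊓ floorGuard c` with gauge constant `B₉·B₃`. [cite: Balaban1985Variational, Thm 1 (8)–(9) p.279, Sect. F pp.300–305, Prop. 8 p.304, (152) p.301, p.304 lines 1–2; Balaban1985RegularSpaces, Prop. 6 p.99; Balaban1984PropagatorsII, (2.3) p.224] -/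
theorem variationalThm1GaugeRegSepCoP7MGB_of_prop8TopStepGB_of_gauge152R {M c : ℕ} {Adm : StepGuard F} {bd : BondDatum F} {Dat : TopData F N} {B₃ B₉ a₀ a₀' a₁ : ℝ}
    (h8 : Prop8RegSepTopStepGB F N (fun ν K Ω => suppDomOfRecord F ν K Ω) Adm bd Dat B₃ a₀ a₁)
    (h152 : Gauge152OfClassTopStepR F N (fun ν K Ω => suppDomOfRecord F ν K Ω) M c B₉ a₀') (hB₃ : 0 < B₃) (ha : B₃ * a₁ ≤ a₀') :
    VariationalThm1GaugeRegSepCoP7MGB F N M (fun ν M g K k s => Adm ν M g K k s ∧ c ≤ ν.M₁) bd Dat B₃ (B₉ * B₃) a₀ a₁ :=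
  variationalThm1GaugeRegSepCoP7MGB_of_gauge9TopStepGB (gauge9GB_of_prop8TopStepGB_of_gauge152R h8 h152 hB₃ ha)

/-- ★★ **THE GUARDED GAUGE `CoP` SENTENCE OVER `(bd, Dat)` FROM F0c's STUB-1 FACT OVER `(bd, Dat)` ∧ [6] PROP. 6 ON PRINT'S CLASS** (stub 2′'s `ρ₀ ≥ 1`; S1b-1 §3's
`gauge9GBP_of_prop8TopStepGB_of_prop6P_of_one_le` then this §3): guard `Adm ⊓ floorGuard ((11·4 + 4·(ρ₀L))·L)`, gauge constant `b9OfP·B₃`, `a0OfP` unchanged.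
[cite: Balaban1985Variational, Thm 1 (8)–(9) p.279, Prop. 8 p.304, (152) p.301; Balaban1985RegularSpaces, Prop. 6 p.99, p.98; Balaban1984PropagatorsII, (2.3) p.224] -/
theorem variationalThm1GaugeRegSepCoP7MGB_of_prop8TopStepGB_of_prop6P_of_one_le {Adm : StepGuard F} {bd : BondDatum F} {Dat : TopData F N} {B₃ a₀ a₁ B₁ c₁ : ℝ}
    (h8 : Prop8RegSepTopStepGB F N (fun ν K Ω => suppDomOfRecord F ν K Ω) Adm bd Dat B₃ a₀ a₁) (hB₁ : 0 ≤ B₁) (hc₁ : 0 < c₁) {ρ₀ : ℕ} (hρ₀ : 1 ≤ ρ₀)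
    (hP6 : letI : CStarAlgebra (MatA N) := {}; B8.Prop6Printed 4 (F.L : ℝ) B₁ c₁ (fun i : ZdIdx 4 F.L => zdCubP (MatA N) F.L ρ₀ i)) (M : ℕ)
    (hB₃ : 0 < B₃) (ha : B₃ * a₁ ≤ a0OfP F N M (ρ₀ * F.L) B₁ c₁) :
    VariationalThm1GaugeRegSepCoP7MGB F N M (fun ν M g K k s => Adm ν M g K k s ∧ (11 * 4 + 4 * (ρ₀ * F.L)) * F.L ≤ ν.M₁) bd Dat B₃
      (b9OfP F M (ρ₀ * F.L) B₁ * B₃) a₀ a₁ :=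
  variationalThm1GaugeRegSepCoP7MGB_of_gauge9TopStepGB (gauge9GBP_of_prop8TopStepGB_of_prop6P_of_one_le h8 hB₁ hc₁ hρ₀ hP6 M hB₃ ha)

/-- Sanity: at the instance `(genSetDatum F, dataSmall7PTopOf F N)` §3's supplier IS module `…GaugeRGuarded` §4's `variationalThm1GaugeRegSepCoP7MG_of_gauge9TopStepG` (same statement,
by `Iff.rfl` on the token and the sentence) — what the `Thm/` road of record reads today. [cite: Balaban1985Variational, Thm 1 (9) p.279 (bookkeeping); Balaban1988Convergent, (2.10) p.256] -/
theorem variationalThm1GaugeRegSepCoP7MG_of_gauge9TopStepG_via_GB {M : ℕ} {Adm : StepGuard F} {B₃ B₃' a₀ a₁ : ℝ}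
    (h9 : Gauge9RegSepTopStepG F N (fun ν K Ω => suppDomOfRecord F ν K Ω) M Adm B₃ B₃' a₀ a₁) : VariationalThm1GaugeRegSepCoP7MG F N M Adm B₃ B₃' a₀ a₁ :=
  variationalThm1GaugeRegSepCoP7MG_iff_GB.2 (variationalThm1GaugeRegSepCoP7MGB_of_gauge9TopStepGB (gauge9RegSepTopStepG_iff_GB.1 h9))

end FromStepGB

end Literature.MathematicalPhysics.QuantumFieldTheory.Balaban1983to89.Node00

end
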